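/-
Origin: written from primary sources — R. Howe, *θ-series and invariant theory*, Proc. Sympos. Pure
Math. 33.1 (1979) §2–§3 (restriction of the oscillator representation to a see-saw sub-pair is the
tensor product of the small oscillator representations up to a character); S. Kudla, *Seesaw dual
reductive pairs* (Katata 1983), Progr. Math. 46 (1984) §1; S. Gelbart, J. Rogawski, Invent. Math.
105 (1991) §3.1, Remark p. 457; A. Weil, Acta Math. 111 (1964) Chap. III n° 41 Thm 6 p. 193
(invariance of `Θ` under rational points). Adapted: no. This file specialises the abstract see-saw
character of `RepresentationTheory/SeesawScalarCharacter` to the external tensor `tensorToSum` of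
adelic Schwartz–Bruhat functions (`AdelicSchwartzBruhatDirectSum`, `…TensorScalar`): the
non-vanishing pair is Weil's witness, the character is `1` at `Θ`-fixing elements, and it is
continuous when the matrix coefficients are. Kernel only; the analytic two-factor Schur statement is
the hypothesis `h`.
-/
import Literature.RepresentationTheory.SeesawScalarCharacter
import Literature.NumberTheory.Automorphic.AdelicSchwartzBruhatTensorScalar
import HarnessLib

/-!
# The adelic see-saw character on `𝒮(𝔸_K^{ι₁ ⊕ ι₂})`: triviality at `Θ`-fixing elements, continuity,
# renormalised restriction identities

For a number field `K`, finite index types `ι₁, ι₂`, a group `G` and three representations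
`M : G →* End 𝒮(𝔸^{ι₁ ⊕ ι₂})`, `A_j : G →* End 𝒮(𝔸^{ι_j})` with the per-element two-factor Schur
statement `h : ∀ g, ∃ c ≠ 0, ∀ Φ₁ Φ₂, M g (Φ₁ ⊠ Φ₂) = c • (A₁ g Φ₁ ⊠ A₂ g Φ₂)`
(`⊠ = tensorToSum K ι₁ ι₂`; for the adelic oscillator representations this is the statement of record
assembled from `SegalBargmann/SchwartzTensorSchur*`, `FiniteAdeleSchwartzBruhatDirectSum` and
`Weil1964/AdelicMetaplecticTensorStripping` — here a HYPOTHESIS):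

* `seesawChar M A₁ A₂ h : G →* ℂˣ` (`SeesawScalar.scalarChar` at `t = tensorToSum`, the
  non-vanishing pair supplied by Weil's witness `exists_tensorToSum_ne_zero'`), `seesawChar_spec`,
  `coe_seesawChar_eq`;
* **`seesawChar_eq_one_of_thetaDistLM`** — `χ(g) = 1` whenever `M g, A₁ g, A₂ g` preserve the theta
  distribution (`tensorScalar_eq_one_of_thetaDistLM`; model case: rational points, [Weil1964] Thm 6);
  `twist_inv_seesawChar_eq_of_thetaDistLM`, `twist_inv_seesawChar_apply_tensorToSum` (scheme (M) on the
  nose), `thetaDistLM_twist_of_eq_one` (transfer of `Θ`-invariance to twisted representations);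
* **`continuous_seesawChar`** — continuity of `χ` from continuity of the matrix coefficients
  `g ↦ (M g Ψ)(x)`, `g ↦ (A_j g Φ)(x)` (locally a ratio of two continuous coefficients);
* the see-saw product group `GV × (U₁ × U₂)` (`A_j` representations of `GV × U_j`): `seesawChar₃`,
  the restriction identities **`seesaw_tensorToSum_twist_small`** / **`seesaw_tensorToSum_twist_big`**
  in the exact shape `M (g,(u₁,u₂)) (Φ₁ ⊠ Φ₂) = A₁′ (g,u₁) Φ₁ ⊠ A₂′ (g,u₂) Φ₂` (scalar `1`), the
  triviality of the three factors `charV/char₁/char₂_eq_one_of_thetaDistLM` at `Θ`-fixing elements, and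
  their continuity `continuous_charV/char₁/char₂`.

Not here: any statement about archimedean components, `K`-types, unitarity, or which scheme a consumer
should use (see the abstract file's closing paragraph).
-/

open NumberField IsDedekindDomain
open Literature.RepresentationTheory.SeesawScalar
open scoped Classical

namespace Literature.NumberTheory.Automorphic

/-! ## The adelic see-saw character -/

section Adelic

open Literature.NumberTheory.Weil1964

variable {K : Type} [Field K] [NumberField K] {ι₁ ι₂ : Type} [Fintype ι₁] [Fintype ι₂]

/-- `𝒮(𝔸^{ι})` has a nonzero element (Weil's witness, `Θ(Φ₀) ≠ 0`). [cite: Weil1964, Chap. III n° 41] -/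
theorem exists_piSchwartzBruhat_ne_zero (ι : Type) [Fintype ι] : ∃ Φ : piSchwartzBruhat K ι, Φ ≠ 0 := by
  obtain ⟨Φ, hΦ⟩ := exists_thetaDistLM_ne_zero K ι
  exact ⟨Φ, fun h => hΦ (by rw [h, map_zero])⟩

/-- The external tensor is not identically zero on `𝒮(𝔸^{ι₁}) × 𝒮(𝔸^{ι₂})`. [folklore] -/
theorem exists_tensorToSum_ne_zero' :
    ∃ (Φ₁ : piSchwartzBruhat K ι₁) (Φ₂ : piSchwartzBruhat K ι₂), tensorToSum K ι₁ ι₂ Φ₁ Φ₂ ≠ 0 := by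
  obtain ⟨Φ₁, h₁⟩ := exists_piSchwartzBruhat_ne_zero (K := K) ι₁
  obtain ⟨Φ₂, h₂⟩ := exists_piSchwartzBruhat_ne_zero (K := K) ι₂
  exact ⟨Φ₁, Φ₂, tensorToSum_ne_zero h₁ h₂⟩

variable {G : Type*} [Group G] (M : Representation ℂ G (piSchwartzBruhat K (ι₁ ⊕ ι₂)))
  (A₁ : Representation ℂ G (piSchwartzBruhat K ι₁)) (A₂ : Representation ℂ G (piSchwartzBruhat K ι₂))
  (h : ∀ g : G, ∃ c : ℂ, c ≠ 0 ∧ ∀ Φ₁ Φ₂,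
    M g (tensorToSum K ι₁ ι₂ Φ₁ Φ₂) = c • tensorToSum K ι₁ ι₂ (A₁ g Φ₁) (A₂ g Φ₂))

/-- **The see-saw character on `𝒮(𝔸^{ι₁ ⊕ ι₂})`**: for three representations of a group `G` on
`𝒮(𝔸^{ι₁ ⊕ ι₂})`, `𝒮(𝔸^{ι₁})`, `𝒮(𝔸^{ι₂})` satisfying the per-element two-factor Schur statement, the
scalars form a character `G →* ℂˣ` (the non-vanishing pair being Weil's witness). (cf. R. Howe (1979) §3)
[folklore] -/
noncomputable def seesawChar : G →* ℂˣ :=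
  scalarChar (tensorToSum K ι₁ ι₂) M A₁ A₂ h exists_tensorToSum_ne_zero'

/-- The defining identity `M g (Φ₁ ⊠ Φ₂) = χ(g) • (A₁ g Φ₁ ⊠ A₂ g Φ₂)`. [folklore] -/
theorem seesawChar_spec (g : G) (Φ₁ : piSchwartzBruhat K ι₁) (Φ₂ : piSchwartzBruhat K ι₂) :
    M g (tensorToSum K ι₁ ι₂ Φ₁ Φ₂) =
      (seesawChar M A₁ A₂ h g : ℂ) • tensorToSum K ι₁ ι₂ (A₁ g Φ₁) (A₂ g Φ₂) :=
  scalarChar_spec _ M A₁ A₂ h _ g Φ₁ Φ₂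

/-- Uniqueness: any scalar that works at `g` is `χ(g)`. [folklore] -/
theorem coe_seesawChar_eq {g : G} {c : ℂ}
    (hc : ∀ Φ₁ Φ₂, M g (tensorToSum K ι₁ ι₂ Φ₁ Φ₂) = c • tensorToSum K ι₁ ι₂ (A₁ g Φ₁) (A₂ g Φ₂)) :
    (seesawChar M A₁ A₂ h g : ℂ) = c :=
  coe_scalarChar_eq _ M A₁ A₂ h _ hc

/-- **`χ(g) = 1` at every element where `M g, A₁ g, A₂ g` preserve the theta distribution** (model
case: `g` a rational point, the three operators being Weil operators of rational elements — Weil's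
Thm 6). [cite: Weil1964, Chap. III n° 41, Thm 6 p. 193] -/
theorem seesawChar_eq_one_of_thetaDistLM {g : G}
    (hM : ∀ Φ, thetaDistLM K (ι₁ ⊕ ι₂) (M g Φ) = thetaDistLM K (ι₁ ⊕ ι₂) Φ)
    (hA₁ : ∀ Φ, thetaDistLM K ι₁ (A₁ g Φ) = thetaDistLM K ι₁ Φ)
    (hA₂ : ∀ Φ, thetaDistLM K ι₂ (A₂ g Φ) = thetaDistLM K ι₂ Φ) :
    seesawChar M A₁ A₂ h g = 1 := by
  apply Units.ext
  rw [Units.val_one]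
  exact tensorScalar_eq_one_of_thetaDistLM (M g) (A₁ g) (A₂ g) _ (seesawChar_spec M A₁ A₂ h g) hM hA₁ hA₂

/-- Hence at such an element the `χ⁻¹`-renormalised big representation agrees with the original.
[folklore] -/
theorem twist_inv_seesawChar_eq_of_thetaDistLM {g : G}
    (hM : ∀ Φ, thetaDistLM K (ι₁ ⊕ ι₂) (M g Φ) = thetaDistLM K (ι₁ ⊕ ι₂) Φ)
    (hA₁ : ∀ Φ, thetaDistLM K ι₁ (A₁ g Φ) = thetaDistLM K ι₁ Φ)
    (hA₂ : ∀ Φ, thetaDistLM K ι₂ (A₂ g Φ) = thetaDistLM K ι₂ Φ) :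
    twist (seesawChar M A₁ A₂ h)⁻¹ M g = M g :=
  twist_apply_of_eq_one M (by rw [MonoidHom.inv_apply, seesawChar_eq_one_of_thetaDistLM M A₁ A₂ h hM hA₁ hA₂, inv_one])

/-- **Scheme (M) on the nose, adelically**: `M′ g (Φ₁ ⊠ Φ₂) = A₁ g Φ₁ ⊠ A₂ g Φ₂` for the
`χ⁻¹`-renormalised big representation. [folklore] -/
theorem twist_inv_seesawChar_apply_tensorToSum (g : G) (Φ₁ : piSchwartzBruhat K ι₁)
    (Φ₂ : piSchwartzBruhat K ι₂) :
    twist (seesawChar M A₁ A₂ h)⁻¹ M g (tensorToSum K ι₁ ι₂ Φ₁ Φ₂) =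
      tensorToSum K ι₁ ι₂ (A₁ g Φ₁) (A₂ g Φ₂) :=
  twist_inv_scalarChar_apply_tensor _ M A₁ A₂ h _ g Φ₁ Φ₂

/-- Transfer of `Θ`-invariance to a twisted representation: if `ρ g` fixes `Θ` and `χ g = 1` then
`(twist χ ρ) g` fixes `Θ`. [folklore] -/
theorem thetaDistLM_twist_of_eq_one {ι : Type} [Fintype ι] {χ : G →* ℂˣ}
    (ρ : Representation ℂ G (piSchwartzBruhat K ι)) {g : G} (hg : χ g = 1)
    (hρ : ∀ Φ, thetaDistLM K ι (ρ g Φ) = thetaDistLM K ι Φ) (Φ : piSchwartzBruhat K ι) :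
    thetaDistLM K ι (twist χ ρ g Φ) = thetaDistLM K ι Φ := by
  rw [twist_apply_of_eq_one ρ hg, hρ]

/-! ### Continuity of the character from continuity of matrix coefficients -/

section Continuity

open _root_.Topology _root_.Filter

variable [TopologicalSpace G]

/-- Pointwise evaluation of a scalar multiple in `𝒮(𝔸^{ι})`. [folklore] -/
theorem piSchwartzBruhat_coe_smul_apply {ι : Type} [Fintype ι] (c : ℂ) (Φ : piSchwartzBruhat K ι)
    (x : ι → AdeleRing (𝓞 K) K) :
    ((c • Φ : piSchwartzBruhat K ι) : (ι → AdeleRing (𝓞 K) K) → ℂ) x = c * (Φ : (ι → AdeleRing (𝓞 K) K) → ℂ) x :=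
  rfl

/-- **Continuity of the see-saw character.**  If the matrix coefficients `g ↦ (M g Ψ)(x)`,
`g ↦ (A₁ g Φ₁)(x₁)`, `g ↦ (A₂ g Φ₂)(x₂)` are continuous (e.g. for the operators of a continuous map into
the adelic metaplectic group with its coefficient topology), then `g ↦ χ(g)` is continuous: near any
`g₀` it is the ratio of two continuous coefficients, the denominator `(A₁ g Φ₁)(x₁) · (A₂ g Φ₂)(x₂)`
being nonzero at `g₀` for a suitable choice of `Φ₁, Φ₂, x`. [folklore] -/
theorem continuous_seesawChar
    (hM : ∀ (Ψ : piSchwartzBruhat K (ι₁ ⊕ ι₂)) (x : ι₁ ⊕ ι₂ → AdeleRing (𝓞 K) K),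
      Continuous fun g : G => ((M g Ψ : piSchwartzBruhat K (ι₁ ⊕ ι₂)) : (ι₁ ⊕ ι₂ → AdeleRing (𝓞 K) K) → ℂ) x)
    (hA₁ : ∀ (Φ : piSchwartzBruhat K ι₁) (x : ι₁ → AdeleRing (𝓞 K) K),
      Continuous fun g : G => ((A₁ g Φ : piSchwartzBruhat K ι₁) : (ι₁ → AdeleRing (𝓞 K) K) → ℂ) x)
    (hA₂ : ∀ (Φ : piSchwartzBruhat K ι₂) (x : ι₂ → AdeleRing (𝓞 K) K),
      Continuous fun g : G => ((A₂ g Φ : piSchwartzBruhat K ι₂) : (ι₂ → AdeleRing (𝓞 K) K) → ℂ) x) :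
    Continuous fun g : G => (seesawChar M A₁ A₂ h g : ℂ) := by
  refine continuous_iff_continuousAt.2 fun g₀ => ?_
  -- a pair with `A₁ g₀ Φ₁ ⊠ A₂ g₀ Φ₂ ≠ 0`, and a point where this function does not vanish
  obtain ⟨Φ₁, Φ₂, hne⟩ :=
    exists_apply_ne_zero (tensorToSum K ι₁ ι₂) A₁ A₂ exists_tensorToSum_ne_zero' g₀
  have hne' : ((tensorToSum K ι₁ ι₂ (A₁ g₀ Φ₁) (A₂ g₀ Φ₂) : piSchwartzBruhat K (ι₁ ⊕ ι₂)) :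
      (ι₁ ⊕ ι₂ → AdeleRing (𝓞 K) K) → ℂ) ≠ 0 := by
    intro h0
    exact hne (Subtype.ext h0)
  obtain ⟨x, hx⟩ := Function.ne_iff.mp hne'
  -- denominator and numerator as continuous functions of `g`
  set D : G → ℂ := fun g =>
    ((A₁ g Φ₁ : piSchwartzBruhat K ι₁) : (ι₁ → AdeleRing (𝓞 K) K) → ℂ) (fun i => x (Sum.inl i)) *
      ((A₂ g Φ₂ : piSchwartzBruhat K ι₂) : (ι₂ → AdeleRing (𝓞 K) K) → ℂ) (fun j => x (Sum.inr j)) with hD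
  set N : G → ℂ := fun g =>
    ((M g (tensorToSum K ι₁ ι₂ Φ₁ Φ₂) : piSchwartzBruhat K (ι₁ ⊕ ι₂)) :
      (ι₁ ⊕ ι₂ → AdeleRing (𝓞 K) K) → ℂ) x with hN
  have hDc : Continuous D := (hA₁ Φ₁ _).mul (hA₂ Φ₂ _)
  have hNc : Continuous N := hM _ x
  have hD0 : D g₀ ≠ 0 := by
    simpa only [hD, coe_tensorToSum, boxTensor_apply, Pi.zero_apply] using hx
  -- the identity `N g = χ(g) * D g` for all `g`
  have hND : ∀ g, N g = (seesawChar M A₁ A₂ h g : ℂ) * D g := by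
    intro g
    have := congr_arg (fun Ψ : piSchwartzBruhat K (ι₁ ⊕ ι₂) =>
      ((Ψ : piSchwartzBruhat K (ι₁ ⊕ ι₂)) : (ι₁ ⊕ ι₂ → AdeleRing (𝓞 K) K) → ℂ) x)
      (seesawChar_spec M A₁ A₂ h g Φ₁ Φ₂)
    simpa only [hN, hD, piSchwartzBruhat_coe_smul_apply, coe_tensorToSum, boxTensor_apply] using this
  -- on the open set `D ≠ 0` the character is the ratio
  have hopen : ∀ᶠ g in 𝓝 g₀, D g ≠ 0 :=
    (isOpen_compl_singleton.preimage hDc).mem_nhds hD0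
  have heq : (fun g => (seesawChar M A₁ A₂ h g : ℂ)) =ᶠ[𝓝 g₀] fun g => N g / D g := by
    filter_upwards [hopen] with g hg
    rw [hND g, mul_div_cancel_right₀ _ hg]
  exact (ContinuousAt.congr ((hNc.continuousAt).div (hDc.continuousAt) hD0) heq.symm)

end Continuity

/-! ### The see-saw product group, adelically -/

section SeesawAdelic

variable {GV U₁ U₂ : Type*} [Group GV] [Group U₁] [Group U₂]
  (M : Representation ℂ (GV × (U₁ × U₂)) (piSchwartzBruhat K (ι₁ ⊕ ι₂)))
  (A₁ : Representation ℂ (GV × U₁) (piSchwartzBruhat K ι₁))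
  (A₂ : Representation ℂ (GV × U₂) (piSchwartzBruhat K ι₂))
  (h : ∀ p : GV × (U₁ × U₂), ∃ c : ℂ, c ≠ 0 ∧ ∀ Φ₁ Φ₂,
    M p (tensorToSum K ι₁ ι₂ Φ₁ Φ₂) =
      c • tensorToSum K ι₁ ι₂ (A₁ (seesawFst GV U₁ U₂ p) Φ₁) (A₂ (seesawSnd GV U₁ U₂ p) Φ₂))

/-- The adelic see-saw character `GV × (U₁ × U₂) →* ℂˣ` of `(M, A₁, A₂)`. (cf. S. Kudla (1984) §1)
[folklore] -/
noncomputable def seesawChar₃ : GV × (U₁ × U₂) →* ℂˣ :=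
  seesawScalarChar (tensorToSum K ι₁ ι₂) M A₁ A₂ h exists_tensorToSum_ne_zero'

/-- **Scheme (small), adelically**: keep `M`; twist `A₁` by `(g,u₁) ↦ λV g · λ₁ u₁`, `A₂` by
`(g,u₂) ↦ λ₂ u₂`; then `M (g,(u₁,u₂)) (Φ₁ ⊠ Φ₂) = A₁′ (g,u₁) Φ₁ ⊠ A₂′ (g,u₂) Φ₂` for all arguments.
[folklore] -/
theorem seesaw_tensorToSum_twist_small (g : GV) (u₁ : U₁) (u₂ : U₂) (Φ₁ : piSchwartzBruhat K ι₁)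
    (Φ₂ : piSchwartzBruhat K ι₂) :
    M (g, (u₁, u₂)) (tensorToSum K ι₁ ι₂ Φ₁ Φ₂) =
      tensorToSum K ι₁ ι₂
        (twist (charSmall₁ (tensorToSum K ι₁ ι₂) M A₁ A₂ h exists_tensorToSum_ne_zero') A₁ (g, u₁) Φ₁)
        (twist (charSmall₂ (tensorToSum K ι₁ ι₂) M A₁ A₂ h exists_tensorToSum_ne_zero') A₂ (g, u₂) Φ₂) :=
  seesaw_restrict_twist_small _ M A₁ A₂ h _ g u₁ u₂ Φ₁ Φ₂

/-- **Scheme (big), adelically** — «`s_V^W ↦ s_V^W · λV⁻¹`, `s_{W_j} ↦ s_{W_j} · λ_j`»: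
`M′ (g,(u₁,u₂)) (Φ₁ ⊠ Φ₂) = A₁′ (g,u₁) Φ₁ ⊠ A₂′ (g,u₂) Φ₂` for all arguments. [folklore] -/
theorem seesaw_tensorToSum_twist_big (g : GV) (u₁ : U₁) (u₂ : U₂) (Φ₁ : piSchwartzBruhat K ι₁)
    (Φ₂ : piSchwartzBruhat K ι₂) :
    twist (charBigV (tensorToSum K ι₁ ι₂) M A₁ A₂ h exists_tensorToSum_ne_zero')⁻¹ M (g, (u₁, u₂))
        (tensorToSum K ι₁ ι₂ Φ₁ Φ₂) =
      tensorToSum K ι₁ ι₂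
        (twist (charBig₁ (tensorToSum K ι₁ ι₂) M A₁ A₂ h exists_tensorToSum_ne_zero') A₁ (g, u₁) Φ₁)
        (twist (charSmall₂ (tensorToSum K ι₁ ι₂) M A₁ A₂ h exists_tensorToSum_ne_zero') A₂ (g, u₂) Φ₂) :=
  seesaw_restrict_twist_big _ M A₁ A₂ h _ g u₁ u₂ Φ₁ Φ₂

/-- **The three see-saw characters are `1` on elements whose operators fix `Θ`.**  If
`M (γ,(1,1))`, `A₁ (γ,1)`, `A₂ (γ,1)` preserve the theta distribution then `λV γ = 1`. (Model case: `γ`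
a rational point of the common member `U(V)`.) [cite: Weil1964, Chap. III n° 41, Thm 6 p. 193] -/
theorem charV_eq_one_of_thetaDistLM {γ : GV}
    (hM : ∀ Φ, thetaDistLM K (ι₁ ⊕ ι₂) (M (γ, (1, 1)) Φ) = thetaDistLM K (ι₁ ⊕ ι₂) Φ)
    (hA₁ : ∀ Φ, thetaDistLM K ι₁ (A₁ (γ, 1) Φ) = thetaDistLM K ι₁ Φ)
    (hA₂ : ∀ Φ, thetaDistLM K ι₂ (A₂ (γ, 1) Φ) = thetaDistLM K ι₂ Φ) :
    charV (tensorToSum K ι₁ ι₂) M A₁ A₂ h exists_tensorToSum_ne_zero' γ = 1 := by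
  rw [charV_apply]
  exact seesawChar_eq_one_of_thetaDistLM M (A₁.comp (seesawFst GV U₁ U₂)) (A₂.comp (seesawSnd GV U₁ U₂))
    h hM hA₁ hA₂

/-- If `M (1,(δ,1))`, `A₁ (1,δ)` preserve the theta distribution then `λ₁ δ = 1`. (Model case: `δ` a
rational point of `U(W₁)`.) [cite: Weil1964, Chap. III n° 41, Thm 6 p. 193] -/
theorem char₁_eq_one_of_thetaDistLM {δ : U₁}
    (hM : ∀ Φ, thetaDistLM K (ι₁ ⊕ ι₂) (M (1, (δ, 1)) Φ) = thetaDistLM K (ι₁ ⊕ ι₂) Φ)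
    (hA₁ : ∀ Φ, thetaDistLM K ι₁ (A₁ (1, δ) Φ) = thetaDistLM K ι₁ Φ) :
    char₁ (tensorToSum K ι₁ ι₂) M A₁ A₂ h exists_tensorToSum_ne_zero' δ = 1 := by
  rw [char₁_apply]
  refine seesawChar_eq_one_of_thetaDistLM M (A₁.comp (seesawFst GV U₁ U₂)) (A₂.comp (seesawSnd GV U₁ U₂))
    h hM hA₁ (fun Φ => ?_)
  show thetaDistLM K ι₂ (A₂ (seesawSnd GV U₁ U₂ (1, (δ, 1))) Φ) = thetaDistLM K ι₂ Φ
  rw [seesawSnd_apply, ← Prod.one_eq_mk, map_one, Module.End.one_apply]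

/-- If `M (1,(1,δ))`, `A₂ (1,δ)` preserve the theta distribution then `λ₂ δ = 1`. (Model case: `δ` a
rational point of `U(W₂)`.) [cite: Weil1964, Chap. III n° 41, Thm 6 p. 193] -/
theorem char₂_eq_one_of_thetaDistLM {δ : U₂}
    (hM : ∀ Φ, thetaDistLM K (ι₁ ⊕ ι₂) (M (1, (1, δ)) Φ) = thetaDistLM K (ι₁ ⊕ ι₂) Φ)
    (hA₂ : ∀ Φ, thetaDistLM K ι₂ (A₂ (1, δ) Φ) = thetaDistLM K ι₂ Φ) :
    char₂ (tensorToSum K ι₁ ι₂) M A₁ A₂ h exists_tensorToSum_ne_zero' δ = 1 := by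
  rw [char₂_apply]
  refine seesawChar_eq_one_of_thetaDistLM M (A₁.comp (seesawFst GV U₁ U₂)) (A₂.comp (seesawSnd GV U₁ U₂))
    h hM (fun Φ => ?_) hA₂
  show thetaDistLM K ι₁ (A₁ (seesawFst GV U₁ U₂ (1, (1, δ))) Φ) = thetaDistLM K ι₁ Φ
  rw [seesawFst_apply, ← Prod.one_eq_mk, map_one, Module.End.one_apply]

/-! #### Continuity of the three factors -/

variable [TopologicalSpace GV] [TopologicalSpace U₁] [TopologicalSpace U₂]

/-- The projection `(g,(u₁,u₂)) ↦ (g,u₁)` is continuous. [folklore] -/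
theorem continuous_seesawFst : Continuous (seesawFst GV U₁ U₂) :=
  continuous_fst.prodMk (continuous_fst.comp continuous_snd)

/-- The projection `(g,(u₁,u₂)) ↦ (g,u₂)` is continuous. [folklore] -/
theorem continuous_seesawSnd : Continuous (seesawSnd GV U₁ U₂) :=
  continuous_fst.prodMk (continuous_snd.comp continuous_snd)

variable
  (hM : ∀ (Ψ : piSchwartzBruhat K (ι₁ ⊕ ι₂)) (x : ι₁ ⊕ ι₂ → AdeleRing (𝓞 K) K),
    Continuous fun p : GV × (U₁ × U₂) =>
      ((M p Ψ : piSchwartzBruhat K (ι₁ ⊕ ι₂)) : (ι₁ ⊕ ι₂ → AdeleRing (𝓞 K) K) → ℂ) x)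
  (hA₁ : ∀ (Φ : piSchwartzBruhat K ι₁) (x : ι₁ → AdeleRing (𝓞 K) K),
    Continuous fun q : GV × U₁ => ((A₁ q Φ : piSchwartzBruhat K ι₁) : (ι₁ → AdeleRing (𝓞 K) K) → ℂ) x)
  (hA₂ : ∀ (Φ : piSchwartzBruhat K ι₂) (x : ι₂ → AdeleRing (𝓞 K) K),
    Continuous fun q : GV × U₂ => ((A₂ q Φ : piSchwartzBruhat K ι₂) : (ι₂ → AdeleRing (𝓞 K) K) → ℂ) x)
include hM hA₁ hA₂

/-- Continuity of the see-saw character on `GV × (U₁ × U₂)` from continuity of the matrix coefficients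
of `M, A₁, A₂`. [folklore] -/
theorem continuous_seesawChar₃ : Continuous fun p : GV × (U₁ × U₂) => (seesawChar₃ M A₁ A₂ h p : ℂ) :=
  continuous_seesawChar M (A₁.comp (seesawFst GV U₁ U₂)) (A₂.comp (seesawSnd GV U₁ U₂)) h hM
    (fun Φ x => (hA₁ Φ x).comp continuous_seesawFst) (fun Φ x => (hA₂ Φ x).comp continuous_seesawSnd)

/-- Continuity of `λV : GV → ℂ`. [folklore] -/
theorem continuous_charV :
    Continuous fun g : GV => (charV (tensorToSum K ι₁ ι₂) M A₁ A₂ h exists_tensorToSum_ne_zero' g : ℂ) :=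
  (continuous_seesawChar₃ M A₁ A₂ h hM hA₁ hA₂).comp (continuous_id.prodMk continuous_const)

/-- Continuity of `λ₁ : U₁ → ℂ`. [folklore] -/
theorem continuous_char₁ :
    Continuous fun u : U₁ => (char₁ (tensorToSum K ι₁ ι₂) M A₁ A₂ h exists_tensorToSum_ne_zero' u : ℂ) :=
  (continuous_seesawChar₃ M A₁ A₂ h hM hA₁ hA₂).comp
    (continuous_const.prodMk (continuous_id.prodMk continuous_const))

/-- Continuity of `λ₂ : U₂ → ℂ`. [folklore] -/
theorem continuous_char₂ :
    Continuous fun u : U₂ => (char₂ (tensorToSum K ι₁ ι₂) M A₁ A₂ h exists_tensorToSum_ne_zero' u : ℂ) :=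
  (continuous_seesawChar₃ M A₁ A₂ h hM hA₁ hA₂).comp
    (continuous_const.prodMk (continuous_const.prodMk continuous_id))

end SeesawAdelic

end Adelic


end Literature.NumberTheory.Automorphic
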